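import Summits.HodgeConjecture.CorCM.MumfordTateRankTimesCMCurveSameField
import Summits.HodgeConjecture.CorCM.MumfordTateRankRibetTimesCMCurveSameField
import Literature.AlgebraicGeometry.Motives.HodgeLieRigidTimesRankOne
import HarnessLib

/-!
# `Θ`-rigidity is inherited by `A × E'` from a `Θ`-rigid `A` with imaginary quadratic `End⁰A = ℚ(√−d)` along a CM elliptic curve `E'` of a
# DIFFERENT field; `t(A × E' × Y) ≥ t(A) + 1` for every `Y`; the fivefold cell `T × E' × E = 11` (Moonen–Zarhin 1999 §3 (3.1), (3.6), (3.8))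

COR-CM (cell `pub-hodgecm2`, seat `b27` gen 50, count-neutral Mumford–Tate-rank ladder; theorems only, no definition, no named fact;
UNCONDITIONAL — nothing here uses or asserts HC_CM).  Notation `t(X) = dim MT(H¹X) = dim Lie Hg(H¹X) + 1`.

The abstract trace test `rigid_of_rigid_of_le_span_singleton_of_trace_ne` (`Motives/HodgeLieRigidTimesRankOne`, gen 49) fed with the data of
`HodgeTheory/RankOneCentreTimesCMCurveInvariance`: for `A` with `dim_ℚ End⁰A = 2`, `φ ∘ φ = −d`, whose `H¹` is `Θ`-RIGID (every bracket-closed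
rational `𝔞 ⊆ Lie Hg(H¹A)` with a Hodge operator in `𝔞 ⊗ ℂ` is all of `Lie Hg(H¹A)`), and an elliptic curve `E'` with `χ ∘ χ = −d'`, `d ≠ q²d'`
for all rational `q`: the centre of `Lie Hg(H¹A)` inside `End_Hdg` lies on `ℚφ^*` (`quadraticEnd_skewCentre_data`), `Lie Hg(H¹E') ⊆ ℚχ^*`
(`RankTwoCM`), the corner `ι₂ χ^* π₂` lies in `Lie Hg(H¹(A × E'))` (`incl_comp_proj_mem_hodgeLie_of_traceSlopes`), and the `Θ`-trace slopes do not
resonate (`traceSlopes_ne_of_forall_ne_sq_mul`) — so **`H¹(A × E')` is `Θ`-rigid**.  With the rigid-factor monotonicity of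
`CorCM/MumfordTateRankRigidMonotone` this bounds every further product from below.

* §1 **`hodgeLie_rigid_prod_cmCurve_of_rigid_of_quadraticEnd`** — the inheritance theorem (any multiplicities on `A`).
* §2 Ribet type `(g − 1, 1)` (`g ≥ 3`; rigid by `hodgeLie_rigid_of_ribetTypeOne`) and simple threefolds with `dim_ℚ End⁰T = 2`:
  **`hodgeLie_rigid_ribetTypeOne_prod_cmCurve_of_isEmpty_ringHom`**, **`hodgeLie_rigid_isSimple_threefold_prod_cmCurve_of_isEmpty_ringHom`**
  (field form: `E'` of CM type with NO ring homomorphism `End⁰E' → End⁰A`).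
* §3 monotonicity: **`mtRank_hodge_one_add_one_le_of_isIsogenous_prod_cmCurve_prod_of_rigid`** (`t(A) + 1 ≤ t(X)` for every
  `X ∼ (A × E') × Y`); Ribet: `g² + 2 ≤ t(X)`; threefold: `11 ≤ t(X)`.
* §4 the fivefold cell **`mtRank_hodge_one_eq_eleven_of_isIsogenous_threefold_prod_cmCurves_of_isEmpty_of_nonempty`**: `T` a simple abelian
  threefold with `dim_ℚ End⁰T = 2`, `E'`, `E` CM elliptic curves with `End⁰E' ↛ End⁰T` and `End⁰E ↪ End⁰T`: **`t(T × E' × E) = 11`**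
  (`11 = t(T × E') ≤ t ≤ t(E × T) + t(E') − 1 = 10 + 1`); Ribet analogue `g² + 2`.

## References
* [MoonenZarhin1999LowDim] B. Moonen, Yu. G. Zarhin, *Hodge classes on abelian varieties of low dimension*, Math. Ann. 315 (1999), §3 (3.1),
  Lemma (3.6), Prop. (3.8), Thm. 0.1 (4) [corpus: paper:arxiv-math_9901113 pp. 1, 6–7]. [cite: MoonenZarhin1999LowDim, §3 (3.1), (3.6) and (3.8)]
* [Deligne1982HodgeCycles] P. Deligne, LNM 900 (1982), I §3.1, Prop. 3.4 and Prop. 3.6. [cite: Deligne1982HodgeCycles, I §3 Prop. 3.6]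
* [Ribet1983] K. A. Ribet, Amer. J. Math. 105 (1983), Thm. 3. [cite: Ribet1983, Thm. 3]
-/

noncomputable section

open scoped TensorProduct
open CategoryTheory CategoryTheory.Limits Module

namespace Summit.HodgeConjecture.CorCM

open Literature.AlgebraicGeometry.Motives
open Literature.AlgebraicGeometry.Motives.AbelianVariety
open Literature.AlgebraicGeometry.Motives.HodgeStructure
open Literature.AlgebraicGeometry.HodgeTheory
open Literature.AlgebraicGeometry.ComplexMultiplication
open Literature.AlgebraicGeometry.Milne1999 (IsOfCMType)

variable [HodgeTensorFacts.{0, 0}] {X A C : AbelianVariety ℂ} {n n₁ : ℕ}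

/-! ## §1 Inheritance of `Θ`-rigidity along a CM elliptic curve of a different field -/

/-- **`H¹(A × E')` is `Θ`-rigid** for `A` with `0 < dim A`, `dim_ℚ End⁰A = 2`, `φ ∘ φ = −d` (`d > 0`) and `Θ`-RIGID `H¹(A)`, and an elliptic curve
`E'` with `χ ∘ χ = −d'` (`d' > 0`), `d ≠ q² d'` for every rational `q` (the fields `ℚ(√−d)`, `ℚ(√−d')` differ).  The trace test of
`Motives/HodgeLieRigidTimesRankOne` on the bicone `H¹(A × E') = fst^* H¹A ⊕ snd^* H¹E'`: centre of `Lie Hg(H¹A)` in `End_Hdg` on `ℚφ^*`, `Lie Hg(H¹E')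
⊆ ℚχ^*`, corner `ι₂ χ^* π₂ ∈ Lie Hg(H¹(A × E'))` (Lemma (3.6)), no resonance `tr(Θ_E' χ^*) tr((φ^*)²) ≠ μ tr((χ^*)²) tr(Θ_A φ^*)`.
[cite: MoonenZarhin1999LowDim, §3 (3.1), (3.6) and (3.8)] [cite: Deligne1982HodgeCycles, I §3 Prop. 3.6] -/
theorem hodgeLie_rigid_prod_cmCurve_of_rigid_of_quadraticEnd (hA : IsSmoothProjective n₁ A.X) {m : ℕ}
    (hP : IsSmoothProjective m (A.prod C).X) (hA0 : 0 < A.dim) (hA2 : Module.finrank ℚ A.endAlgebra = 2)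
    (φ : A ⟶ A) {d : ℕ} (hd : 0 < d) (hφ : φ ≫ φ = -(d • 𝟙 A))
    (hrigA : haveI := BettiUniverse.finite hA 1
      ∀ 𝔞 : Submodule ℚ (Module.End ℚ (bettiCohomology A.X 1)),
        𝔞 ≤ (BettiUniverse.hodge exists_isReal_hodgeModel_holds hA 1).hodgeLie →
        (∀ B ∈ 𝔞, ∀ B' ∈ 𝔞, B * B' - B' * B ∈ 𝔞) →
        (∃ Θ ∈ Submodule.span ℂ ((fun B : Module.End ℚ (bettiCohomology A.X 1) => B.baseChange ℂ) ''
            (𝔞 : Set (Module.End ℚ (bettiCohomology A.X 1)))),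
          ∀ p, ∀ x ∈ (BettiUniverse.hodge exists_isReal_hodgeModel_holds hA 1).piece p (((1 : ℕ) : ℤ) - p),
            Θ x = ((2 * p - ((1 : ℕ) : ℤ) : ℤ) : ℂ) • x) →
        (BettiUniverse.hodge exists_isReal_hodgeModel_holds hA 1).hodgeLie ≤ 𝔞)
    (hC1 : C.dim = 1) (χ : C ⟶ C) {d' : ℕ} (hd' : 0 < d') (hχ : χ ≫ χ = -(d' • 𝟙 C)) (hfree : ∀ q : ℚ, (d : ℚ) ≠ q ^ 2 * d') :
    haveI := BettiUniverse.finite hP 1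
    ∀ 𝔞 : Submodule ℚ (Module.End ℚ (bettiCohomology (A.prod C).X 1)),
      𝔞 ≤ (BettiUniverse.hodge exists_isReal_hodgeModel_holds hP 1).hodgeLie →
      (∀ B ∈ 𝔞, ∀ B' ∈ 𝔞, B * B' - B' * B ∈ 𝔞) →
      (∃ Θ ∈ Submodule.span ℂ ((fun B : Module.End ℚ (bettiCohomology (A.prod C).X 1) => B.baseChange ℂ) ''
          (𝔞 : Set (Module.End ℚ (bettiCohomology (A.prod C).X 1)))),
        ∀ p, ∀ x ∈ (BettiUniverse.hodge exists_isReal_hodgeModel_holds hP 1).piece p (((1 : ℕ) : ℤ) - p),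
          Θ x = ((2 * p - ((1 : ℕ) : ℤ) : ℤ) : ℂ) • x) →
      (BettiUniverse.hodge exists_isReal_hodgeModel_holds hP 1).hodgeLie ≤ 𝔞 := by
  classical
  have hnA : A.dim = n₁ := schemeDim_eq_holds hA
  subst hnA
  have hC : IsSmoothProjective C.dim C.X := AbelianVariety.isSmoothProjective_holds
  haveI := BettiUniverse.finite hP 1
  haveI := BettiUniverse.finite hA 1
  haveI := BettiUniverse.finite hC 1
  -- the bicone of `H¹`
  let ι₁ := BettiUniverse.pullHodgeHom exists_isReal_hodgeModel_holds hodgePQ_independent_of_hodgeModel_holds hP hA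
    (fst A C).hom.hom.hom 1
  let π₁ := BettiUniverse.pullHodgeHom exists_isReal_hodgeModel_holds hodgePQ_independent_of_hodgeModel_holds hA hP
    (prodLift (𝟙 A) (0 : A ⟶ C)).hom.hom.hom 1
  let ι₂ := BettiUniverse.pullHodgeHom exists_isReal_hodgeModel_holds hodgePQ_independent_of_hodgeModel_holds hP hC
    (snd A C).hom.hom.hom 1
  let π₂ := BettiUniverse.pullHodgeHom exists_isReal_hodgeModel_holds hodgePQ_independent_of_hodgeModel_holds hC hP
    (prodLift (0 : C ⟶ A) (𝟙 C)).hom.hom.hom 1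
  have hsumP : fst A C ≫ prodLift (𝟙 A) (0 : A ⟶ C) + snd A C ≫ prodLift (0 : C ⟶ A) (𝟙 C) = 𝟙 _ := by
    refine prod_hom_ext ?_ ?_
    · rw [Preadditive.add_comp, Category.assoc, Category.assoc, prodLift_fst, prodLift_fst, Category.comp_id,
        comp_zero, add_zero, Category.id_comp]
    · rw [Preadditive.add_comp, Category.assoc, Category.assoc, prodLift_snd, prodLift_snd, Category.comp_id,
        comp_zero, zero_add, Category.id_comp]
  have hπι₁ : ∀ v, π₁.toLinearMap (ι₁.toLinearMap v) = v := fun v => pull_pull_eq_self_of_comp_eq_id (prodLift_fst _ _) v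
  have hπι₂ : ∀ v, π₂.toLinearMap (ι₂.toLinearMap v) = v := fun v => pull_pull_eq_self_of_comp_eq_id (prodLift_snd _ _) v
  have hsum : ∀ v, ι₁.toLinearMap (π₁.toLinearMap v) + ι₂.toLinearMap (π₂.toLinearMap v) = v := fun v =>
    pull_pull_add_pull_pull_eq_self _ _ _ _ hsumP v
  -- polarizations, Hodge operators
  obtain ⟨ψ⟩ := BettiUniverse.hodge_isPolarizable exists_isReal_hodgeModel_holds hP 1
  obtain ⟨ψ₁⟩ := BettiUniverse.hodge_isPolarizable exists_isReal_hodgeModel_holds hA 1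
  obtain ⟨ψ₂⟩ := BettiUniverse.hodge_isPolarizable exists_isReal_hodgeModel_holds hC 1
  obtain ⟨Θ₁, hΘ₁⟩ := exists_hodgeTheta (BettiUniverse.hodge exists_isReal_hodgeModel_holds hA 1)
  obtain ⟨Θ₂, hΘ₂⟩ := exists_hodgeTheta (BettiUniverse.hodge exists_isReal_hodgeModel_holds hC 1)
  -- the data on `A`: `φ^*`, skew centre `ℚφ^*`
  obtain ⟨hφE, -, hZ⟩ := quadraticEnd_skewCentre_data exists_isReal_hodgeModel_holds hodgePQ_independent_of_hodgeModel_holds hA0 hA2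
    hd hφ ψ₁
  -- the data on `E'`: `χ^*`, `(χ^*)² = -d'`, `dim H¹(E') = 2`
  have hχE := pullback_mem_endAlg exists_isReal_hodgeModel_holds hodgePQ_independent_of_hodgeModel_holds χ
  have hχ2 : (bettiCohomology.map χ.hom.hom.hom 1).hom * (bettiCohomology.map χ.hom.hom.hom 1).hom = -((d' : ℚ) • 1) :=
    bettiMapHom_mul_self hχ
  have hd'Q : (0 : ℚ) < d' := Nat.cast_pos.2 hd'
  have hV₂ : Module.finrank ℚ (bettiCohomology C.X 1) = 2 := by rw [finrank_bettiCohomology_one C, hC1]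
  have heff₂ := BettiUniverse.hodge_isEffective exists_isReal_hodgeModel_holds hC 1
  -- non-resonance of the `Θ`-trace slopes and the corner `ι₂ χ^* π₂ ∈ Lie Hg(H¹(A × E'))`
  have hres := traceSlopes_ne_of_forall_ne_sq_mul exists_isReal_hodgeModel_holds hodgePQ_independent_of_hodgeModel_holds hA0 hd hφ
    hC1 hd' hχ hfree hΘ₁ hΘ₂
  have hcorner := incl_comp_proj_mem_hodgeLie_of_traceSlopes ι₁ π₁ ι₂ π₂ hπι₁ hπι₂ hsum Nat.cast_one heff₂ ψ ψ₁ ψ₂ hφE hZ hχE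
    hd'Q hχ2 hV₂ hΘ₁ hΘ₂ hres
  -- `Lie Hg(H¹E') ⊆ ℚχ^*`
  have hy₀ : (BettiUniverse.hodge exists_isReal_hodgeModel_holds hC 1).hodgeLie ≤ ℚ ∙ (bettiCohomology.map χ.hom.hom.hom 1).hom := by
    intro R hR
    obtain ⟨c, hc⟩ := RankTwoCM.exists_eq_ratCast_smul_of_commute_of_skew _ Nat.cast_one heff₂ hV₂ ψ₂ hχE hd'Q hχ2
      (commute_of_mem_hodgeLie _ hR ⟨_, hχE⟩) (form_apply_add_eq_zero_of_mem_hodgeLie ψ₂ hR)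
    exact Submodule.mem_span_singleton.2 ⟨c, hc.symm⟩
  -- the centre of `Lie Hg(H¹A)` inside `End_Hdg(H¹A)` lies on `ℚφ^*`
  have hcen : (BettiUniverse.hodge exists_isReal_hodgeModel_holds hA 1).hodgeLie ⊓
      Subalgebra.toSubmodule (BettiUniverse.hodge exists_isReal_hodgeModel_holds hA 1).endAlg ≤
        ℚ ∙ (bettiCohomology.map φ.hom.hom.hom 1).hom := by
    intro a ha
    obtain ⟨ha𝔥, haE⟩ := Submodule.mem_inf.1 ha
    obtain ⟨x, hx⟩ := hZ a haE (fun b hb => commute_of_mem_hodgeLie _ ha𝔥 ⟨b, hb⟩)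
      (form_apply_add_eq_zero_of_mem_hodgeLie ψ₁ ha𝔥)
    exact Submodule.mem_span_singleton.2 ⟨x, hx.symm⟩
  -- the trace test
  refine rigid_of_rigid_of_le_span_singleton_of_trace_ne ι₁ π₁ ι₂ π₂ hπι₁ hπι₂ hsum hrigA hy₀ hcorner ψ₁ hφE hcen ?_
  intro Θ₁' hΘ₁' Θ₂' hΘ₂' μ hμ
  refine traceSlopes_ne_of_forall_ne_sq_mul exists_isReal_hodgeModel_holds hodgePQ_independent_of_hodgeModel_holds hA0 hd hφ hC1 hd'
    hχ hfree hΘ₁' hΘ₂' μ ?_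
  linear_combination hμ

/-! ## §2 Ribet type `(g − 1, 1)` and simple threefolds with quadratic endomorphism field, times a CM curve of another field -/

/-- **`H¹(A × E')` is `Θ`-rigid for `A` of Ribet type `(g − 1, 1)` and a CM elliptic curve `E'` whose field does not map to `End⁰A`**:
`dim A ≥ 3`, `dim_ℚ End⁰A = 2`, `φ ∘ φ = −d` with multiplicity one at `i√d` or at `−i√d` on `H^{1,0}(A)` (rigid by `hodgeLie_rigid_of_ribetTypeOne`),
`E'` of CM type with no ring homomorphism `End⁰E' → End⁰A` (`d ≠ q²d'`, `forall_ne_sq_mul_of_isEmpty_ringHom`).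
[cite: MoonenZarhin1999LowDim, §3 (3.1) and (3.8)] [cite: Ribet1983, Thm. 3] -/
theorem hodgeLie_rigid_ribetTypeOne_prod_cmCurve_of_isEmpty_ringHom {m : ℕ} (hP : IsSmoothProjective m (A.prod C).X)
    (φ : A ⟶ A) {d : ℕ} (hd : 0 < d) (hφ : φ ≫ φ = -(d • 𝟙 A)) (hA2 : Module.finrank ℚ A.endAlgebra = 2)
    (h1 : eigenMultiplicity A φ (Complex.I * (Real.sqrt d : ℂ)) = 1 ∨ eigenMultiplicity A φ (-(Complex.I * (Real.sqrt d : ℂ))) = 1)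
    (hdim : 3 ≤ A.dim) (hC1 : C.dim = 1) (hCcm : IsOfCMType C) (hfor : IsEmpty (C.endAlgebra →+* A.endAlgebra)) :
    haveI := BettiUniverse.finite hP 1
    ∀ 𝔞 : Submodule ℚ (Module.End ℚ (bettiCohomology (A.prod C).X 1)),
      𝔞 ≤ (BettiUniverse.hodge exists_isReal_hodgeModel_holds hP 1).hodgeLie →
      (∀ B ∈ 𝔞, ∀ B' ∈ 𝔞, B * B' - B' * B ∈ 𝔞) →
      (∃ Θ ∈ Submodule.span ℂ ((fun B : Module.End ℚ (bettiCohomology (A.prod C).X 1) => B.baseChange ℂ) ''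
          (𝔞 : Set (Module.End ℚ (bettiCohomology (A.prod C).X 1)))),
        ∀ p, ∀ x ∈ (BettiUniverse.hodge exists_isReal_hodgeModel_holds hP 1).piece p (((1 : ℕ) : ℤ) - p),
          Θ x = ((2 * p - ((1 : ℕ) : ℤ) : ℤ) : ℂ) • x) →
      (BettiUniverse.hodge exists_isReal_hodgeModel_holds hP 1).hodgeLie ≤ 𝔞 := by
  have hA : IsSmoothProjective A.dim A.X := AbelianVariety.isSmoothProjective_holds
  obtain ⟨χ, d', hd', hχ⟩ := exists_hom_comp_self_eq_neg_of_cmCurve hC1 hCcm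
  exact hodgeLie_rigid_prod_cmCurve_of_rigid_of_quadraticEnd hA hP (by omega) hA2 φ hd hφ
    (hodgeLie_rigid_of_ribetTypeOne hA φ hd hφ hA2 h1 hdim) hC1 χ hd' hχ
    (forall_ne_sq_mul_of_isEmpty_ringHom hfor (finrank_endAlgebra_eq_two_of_cmCurve hC1 hCcm) hd' hχ hφ hd)

/-- **`H¹(T × E')` is `Θ`-rigid for a SIMPLE abelian THREEFOLD `T` with `dim_ℚ End⁰T = 2` and a CM elliptic curve `E'` with `End⁰E' ↛ End⁰T`**
(type IV(1,1): `End⁰T = ℚ(√−d)`, multiplicities `(2,1)` — Ribet type with `g = 3`). [cite: MoonenZarhin1999LowDim, §2 (2.3) and §3 (3.8)]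
[cite: Ribet1983, Thm. 3] -/
theorem hodgeLie_rigid_isSimple_threefold_prod_cmCurve_of_isEmpty_ringHom {T : AbelianVariety ℂ} {m : ℕ}
    (hP : IsSmoothProjective m (T.prod C).X) (hTs : T.IsSimple) (hT3 : T.dim = 3) (hTE : Module.finrank ℚ T.endAlgebra = 2)
    (hC1 : C.dim = 1) (hCcm : IsOfCMType C) (hfor : IsEmpty (C.endAlgebra →+* T.endAlgebra)) :
    haveI := BettiUniverse.finite hP 1
    ∀ 𝔞 : Submodule ℚ (Module.End ℚ (bettiCohomology (T.prod C).X 1)),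
      𝔞 ≤ (BettiUniverse.hodge exists_isReal_hodgeModel_holds hP 1).hodgeLie →
      (∀ B ∈ 𝔞, ∀ B' ∈ 𝔞, B * B' - B' * B ∈ 𝔞) →
      (∃ Θ ∈ Submodule.span ℂ ((fun B : Module.End ℚ (bettiCohomology (T.prod C).X 1) => B.baseChange ℂ) ''
          (𝔞 : Set (Module.End ℚ (bettiCohomology (T.prod C).X 1)))),
        ∀ p, ∀ x ∈ (BettiUniverse.hodge exists_isReal_hodgeModel_holds hP 1).piece p (((1 : ℕ) : ℤ) - p),
          Θ x = ((2 * p - ((1 : ℕ) : ℤ) : ℤ) : ℂ) • x) →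
      (BettiUniverse.hodge exists_isReal_hodgeModel_holds hP 1).hodgeLie ≤ 𝔞 := by
  have hT : IsSmoothProjective T.dim T.X := AbelianVariety.isSmoothProjective_holds
  obtain ⟨φ, d, hd, hφ⟩ := exists_hom_comp_self_eq_neg_of_isSimple_threefold_of_finrank_eq_two hTs hT3 hTE
  obtain ⟨χ, d', hd', hχ⟩ := exists_hom_comp_self_eq_neg_of_cmCurve hC1 hCcm
  exact hodgeLie_rigid_prod_cmCurve_of_rigid_of_quadraticEnd hT hP (by omega) hTE φ hd hφ
    (hodgeLie_rigid_of_isSimple_threefold_of_finrank_endAlgebra_eq_two hT hTs hT3 hTE) hC1 χ hd' hχ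
    (forall_ne_sq_mul_of_isEmpty_ringHom hfor (finrank_endAlgebra_eq_two_of_cmCurve hC1 hCcm) hd' hχ hφ hd)

/-! ## §3 Monotonicity: `t(A × E' × Y) ≥ t(A × E') = t(A) + 1` -/

/-- **`t(A) + 1 ≤ t(X)` for every `X ∼ (A × E') × Y`**: `A` with `0 < dim A`, `dim_ℚ End⁰A = 2`, `φ ∘ φ = −d`, `Θ`-rigid `H¹(A)`; `E'` a CM elliptic
curve with no ring homomorphism `End⁰E' → End⁰A`; `Y` arbitrary.  (`t(A × E') = t(A) + 1` by Prop. (3.8), `CorCM/MumfordTateRankTimesCMCurve`, and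
`H¹(A × E')` is `Θ`-rigid by §1, so the rigid-factor monotonicity of `CorCM/MumfordTateRankRigidMonotone` applies.)
[cite: MoonenZarhin1999LowDim, §3 (3.1) and (3.8)] -/
theorem mtRank_hodge_one_add_one_le_of_isIsogenous_prod_cmCurve_prod_of_rigid (hX : IsSmoothProjective n X.X)
    (hA : IsSmoothProjective n₁ A.X) (hA0 : 0 < A.dim) (hA2 : Module.finrank ℚ A.endAlgebra = 2)
    (φ : A ⟶ A) {d : ℕ} (hd : 0 < d) (hφ : φ ≫ φ = -(d • 𝟙 A))
    (hrigA : haveI := BettiUniverse.finite hA 1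
      ∀ 𝔞 : Submodule ℚ (Module.End ℚ (bettiCohomology A.X 1)),
        𝔞 ≤ (BettiUniverse.hodge exists_isReal_hodgeModel_holds hA 1).hodgeLie →
        (∀ B ∈ 𝔞, ∀ B' ∈ 𝔞, B * B' - B' * B ∈ 𝔞) →
        (∃ Θ ∈ Submodule.span ℂ ((fun B : Module.End ℚ (bettiCohomology A.X 1) => B.baseChange ℂ) ''
            (𝔞 : Set (Module.End ℚ (bettiCohomology A.X 1)))),
          ∀ p, ∀ x ∈ (BettiUniverse.hodge exists_isReal_hodgeModel_holds hA 1).piece p (((1 : ℕ) : ℤ) - p),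
            Θ x = ((2 * p - ((1 : ℕ) : ℤ) : ℤ) : ℂ) • x) →
        (BettiUniverse.hodge exists_isReal_hodgeModel_holds hA 1).hodgeLie ≤ 𝔞)
    (hC1 : C.dim = 1) (hCcm : IsOfCMType C) (hfor : IsEmpty (C.endAlgebra →+* A.endAlgebra)) {Y : AbelianVariety ℂ}
    (hXP : IsIsogenous X ((A.prod C).prod Y)) :
    haveI := BettiUniverse.finite hX 1
    haveI := BettiUniverse.finite hA 1
    (BettiUniverse.hodge exists_isReal_hodgeModel_holds hA 1).mtRank + 1 ≤ (BettiUniverse.hodge exists_isReal_hodgeModel_holds hX 1).mtRank := by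
  have hnA : A.dim = n₁ := schemeDim_eq_holds hA
  subst hnA
  haveI := BettiUniverse.finite hX 1
  haveI := BettiUniverse.finite hA 1
  have hP : IsSmoothProjective (A.prod C).dim (A.prod C).X := AbelianVariety.isSmoothProjective_holds
  haveI := BettiUniverse.finite hP 1
  obtain ⟨χ, d', hd', hχ⟩ := exists_hom_comp_self_eq_neg_of_cmCurve hC1 hCcm
  have hrig := hodgeLie_rigid_prod_cmCurve_of_rigid_of_quadraticEnd hA hP hA0 hA2 φ hd hφ hrigA hC1 χ hd' hχ
    (forall_ne_sq_mul_of_isEmpty_ringHom hfor (finrank_endAlgebra_eq_two_of_cmCurve hC1 hCcm) hd' hχ hφ hd)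
  have hle := mtRank_hodge_one_le_of_isIsogenous_prod_of_rigid (X₂ := Y) hX hP (by rw [dim_prod]; omega) hrig hXP
  have hAC := mtRank_hodge_one_eq_add_one_of_isIsogenous_prod_of_isEmpty_ringHom hP hA hA0 hA2 φ hd hφ hC1 hCcm hfor
    (IsIsogenous.refl _)
  omega

/-- **`g² + 2 ≤ t(X)` for every `X ∼ (A × E') × Y`, `A` of Ribet type `(g − 1, 1)`, `E'` a CM elliptic curve with `End⁰E' ↛ End⁰A`** (`Y` arbitrary;
`t(A × E') = g² + 2`). [cite: MoonenZarhin1999LowDim, §3 (3.1) and (3.8)] [cite: Ribet1983, Thm. 3] -/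
theorem mtRank_hodge_one_le_of_isIsogenous_ribetTypeOne_prod_cmCurve_prod (hX : IsSmoothProjective n X.X) (hF : IsField A.endAlgebra)
    (hnR : ¬ NumberField.IsTotallyReal (EndField A hF)) (φ : A ⟶ A) {d : ℕ} (hd : 0 < d) (hφ : φ ≫ φ = -(d • 𝟙 A))
    (hA2 : Module.finrank ℚ A.endAlgebra = 2)
    (h1 : eigenMultiplicity A φ (Complex.I * (Real.sqrt d : ℂ)) = 1 ∨ eigenMultiplicity A φ (-(Complex.I * (Real.sqrt d : ℂ))) = 1)
    (hdim : 3 ≤ A.dim) (hC1 : C.dim = 1) (hCcm : IsOfCMType C) (hfor : IsEmpty (C.endAlgebra →+* A.endAlgebra)) {Y : AbelianVariety ℂ}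
    (hXP : IsIsogenous X ((A.prod C).prod Y)) :
    haveI := BettiUniverse.finite hX 1
    A.dim * A.dim + 2 ≤ (BettiUniverse.hodge exists_isReal_hodgeModel_holds hX 1).mtRank := by
  have hA : IsSmoothProjective A.dim A.X := AbelianVariety.isSmoothProjective_holds
  haveI := BettiUniverse.finite hX 1
  haveI := BettiUniverse.finite hA 1
  have hgg := (mtRank_hodge_one_of_ribetTypeOne' hA hF hnR φ hd hφ hA2 h1 hdim).1
  have h := mtRank_hodge_one_add_one_le_of_isIsogenous_prod_cmCurve_prod_of_rigid hX hA (by omega) hA2 φ hd hφ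
    (hodgeLie_rigid_of_ribetTypeOne hA φ hd hφ hA2 h1 hdim) hC1 hCcm hfor hXP
  omega

/-- **`11 ≤ t(X)` for every `X ∼ (T × E') × Y`, `T` a simple abelian threefold with `dim_ℚ End⁰T = 2`, `E'` a CM elliptic curve with
`End⁰E' ↛ End⁰T`** (`t(T × E') = 11`, `H¹(T × E')` is `Θ`-rigid; `Y` arbitrary). [cite: MoonenZarhin1999LowDim, §2 (2.3), §3 (3.1) and (3.8)] -/
theorem eleven_le_mtRank_hodge_one_of_isIsogenous_threefold_prod_cmCurve_prod (hX : IsSmoothProjective n X.X) {T : AbelianVariety ℂ}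
    (hTs : T.IsSimple) (hT3 : T.dim = 3) (hTE : Module.finrank ℚ T.endAlgebra = 2) (hC1 : C.dim = 1) (hCcm : IsOfCMType C)
    (hfor : IsEmpty (C.endAlgebra →+* T.endAlgebra)) {Y : AbelianVariety ℂ} (hXP : IsIsogenous X ((T.prod C).prod Y)) :
    haveI := BettiUniverse.finite hX 1
    11 ≤ (BettiUniverse.hodge exists_isReal_hodgeModel_holds hX 1).mtRank := by
  have hT : IsSmoothProjective T.dim T.X := AbelianVariety.isSmoothProjective_holds
  haveI := BettiUniverse.finite hX 1
  haveI := BettiUniverse.finite hT 1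
  obtain ⟨φ, d, hd, hφ⟩ := exists_hom_comp_self_eq_neg_of_isSimple_threefold_of_finrank_eq_two hTs hT3 hTE
  have h10 : (BettiUniverse.hodge exists_isReal_hodgeModel_holds hT 1).mtRank = 10 :=
    (mtRank_hodge_one_of_isSimple_threefold_of_finrank_endAlgebra_eq_two hT hTs hT3 hTE).1
  have h := mtRank_hodge_one_add_one_le_of_isIsogenous_prod_cmCurve_prod_of_rigid hX hT (by omega) hTE φ hd hφ
    (hodgeLie_rigid_of_isSimple_threefold_of_finrank_endAlgebra_eq_two hT hTs hT3 hTE) hC1 hCcm hfor hXP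
  omega

/-! ## §4 The fivefold cell: simple type-IV(2,1) threefold × CM curve of another field × CM curve of the same field -/

/-- **`t(T × E' × E) = 11`** for a simple abelian threefold `T` with `dim_ℚ End⁰T = 2` (`End⁰T = k` imaginary quadratic, `t(T) = 10`), a CM
elliptic curve `E'` with `End⁰E' ↛ k` and a CM elliptic curve `E` with `End⁰E ↪ k`: `11 = t(T × E') ≤ t(X)` (§3) and
`t(X) + 1 ≤ t(E × T) + t(E') = 10 + 2` (`CorCM/MumfordTateRankTimesCMCurveSameField`, `CorCM/MumfordTateRankSubadditive`).  `Hg = U(2,1) × U(1)`: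
the curve of the same field adds nothing, the other one adds its torus. [cite: MoonenZarhin1999LowDim, Thm. 0.1 (4), §3 (3.1) and (3.8)] -/
theorem mtRank_hodge_one_eq_eleven_of_isIsogenous_threefold_prod_cmCurves_of_isEmpty_of_nonempty (hX : IsSmoothProjective n X.X)
    {T E' E : AbelianVariety ℂ} (hTs : T.IsSimple) (hT3 : T.dim = 3) (hTE : Module.finrank ℚ T.endAlgebra = 2)
    (hE'1 : E'.dim = 1) (hE'cm : IsOfCMType E') (hfor' : IsEmpty (E'.endAlgebra →+* T.endAlgebra))
    (hE1 : E.dim = 1) (hEcm : IsOfCMType E) (hfor : Nonempty (E.endAlgebra →+* T.endAlgebra))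
    (hXP : IsIsogenous X (T.prod (E'.prod E))) :
    haveI := BettiUniverse.finite hX 1
    (BettiUniverse.hodge exists_isReal_hodgeModel_holds hX 1).mtRank = 11 := by
  haveI := BettiUniverse.finite hX 1
  have hET : IsSmoothProjective (E.prod T).dim (E.prod T).X := AbelianVariety.isSmoothProjective_holds
  have hE' : IsSmoothProjective E'.dim E'.X := AbelianVariety.isSmoothProjective_holds
  haveI := BettiUniverse.finite hET 1
  haveI := BettiUniverse.finite hE' 1
  -- lower bound: `X ∼ (T × E') × E`
  have hge := eleven_le_mtRank_hodge_one_of_isIsogenous_threefold_prod_cmCurve_prod hX hTs hT3 hTE hE'1 hE'cm hfor' (Y := E)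
    (hXP.trans (Literature.AlgebraicGeometry.HodgeTheory.isIsogenous_prod_assoc T E' E).symm')
  -- upper bound: `X ∼ (E × T) × E'`, `t(E × T) = 10`, `t(E') = 2`
  have hXQ : IsIsogenous X ((E.prod T).prod E') :=
    (hXP.trans ((IsIsogenous.refl T).prod (isIsogenous_prod_comm E' E))).trans
      ((Literature.AlgebraicGeometry.HodgeTheory.isIsogenous_prod_assoc T E E').symm'.trans
        ((isIsogenous_prod_comm T E).prod (IsIsogenous.refl E')))
  have h10 := mtRank_hodge_one_eq_ten_of_isIsogenous_cmCurve_prod_isSimple_threefold_of_nonempty_ringHom hET hE1 hEcm hTs hT3 hTE hfor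
    (IsIsogenous.refl _)
  have h2 := mtRank_hodge_one_eq_two_of_cm_curve hE'1 hE'cm
  have hle := mtRank_hodge_one_add_one_le_add_of_isIsogenous_prod hET hE' (by rw [dim_prod]; omega) (by omega) hX hXQ
  omega

/-- **Ribet analogue: `t(A × E' × E) = g² + 2`** for `A` of Ribet type `(g − 1, 1)` with `φ ∘ φ = −D`, a CM elliptic curve `E'` with `End⁰E' ↛ End⁰A`
and an elliptic curve `E` admitting `χ ∘ χ = −D` (the same field): `g² + 2 = t(A × E') ≤ t(X) ≤ t(E × A) + t(E') − 1 = (g² + 1) + 1`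
(`CorCM/MumfordTateRankRibetTimesCMCurveSameField`). [cite: MoonenZarhin1999LowDim, Thm. 0.1 (4), §3 (3.1) and (3.8)] [cite: Ribet1983, Thm. 3] -/
theorem mtRank_hodge_one_of_isIsogenous_ribetTypeOne_prod_cmCurves_of_isEmpty_of_sameField (hX : IsSmoothProjective n X.X)
    {E' E : AbelianVariety ℂ} (hF : IsField A.endAlgebra) (hnR : ¬ NumberField.IsTotallyReal (EndField A hF)) (φ : A ⟶ A) {D : ℕ}
    (hD : 0 < D) (hφ : φ ≫ φ = -(D • 𝟙 A)) (hA2 : Module.finrank ℚ A.endAlgebra = 2)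
    (h1 : eigenMultiplicity A φ (Complex.I * (Real.sqrt D : ℂ)) = 1 ∨ eigenMultiplicity A φ (-(Complex.I * (Real.sqrt D : ℂ))) = 1)
    (hdim : 3 ≤ A.dim) (hE'1 : E'.dim = 1) (hE'cm : IsOfCMType E') (hfor' : IsEmpty (E'.endAlgebra →+* A.endAlgebra))
    (hE1 : E.dim = 1) (hEχ : ∃ χ : E ⟶ E, χ ≫ χ = -(D • 𝟙 E)) (hXP : IsIsogenous X (A.prod (E'.prod E))) :
    haveI := BettiUniverse.finite hX 1
    (BettiUniverse.hodge exists_isReal_hodgeModel_holds hX 1).mtRank = A.dim * A.dim + 2 := by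
  haveI := BettiUniverse.finite hX 1
  have hEA : IsSmoothProjective (E.prod A).dim (E.prod A).X := AbelianVariety.isSmoothProjective_holds
  have hE' : IsSmoothProjective E'.dim E'.X := AbelianVariety.isSmoothProjective_holds
  haveI := BettiUniverse.finite hEA 1
  haveI := BettiUniverse.finite hE' 1
  have hge := mtRank_hodge_one_le_of_isIsogenous_ribetTypeOne_prod_cmCurve_prod hX hF hnR φ hD hφ hA2 h1 hdim hE'1 hE'cm hfor' (Y := E)
    (hXP.trans (Literature.AlgebraicGeometry.HodgeTheory.isIsogenous_prod_assoc A E' E).symm')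
  have hXQ : IsIsogenous X ((E.prod A).prod E') :=
    (hXP.trans ((IsIsogenous.refl A).prod (isIsogenous_prod_comm E' E))).trans
      ((Literature.AlgebraicGeometry.HodgeTheory.isIsogenous_prod_assoc A E E').symm'.trans
        ((isIsogenous_prod_comm A E).prod (IsIsogenous.refl E')))
  have hgg := mtRank_hodge_one_eq_of_isIsogenous_ribetTypeOne_prod_cmCurve_of_exists_comp_self_eq_neg hEA hF hnR φ hD hφ hA2 h1 hdim hE1
    hEχ (IsIsogenous.refl _)
  have h2 := mtRank_hodge_one_eq_two_of_cm_curve hE'1 hE'cm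
  have hle := mtRank_hodge_one_add_one_le_add_of_isIsogenous_prod hEA hE' (by rw [dim_prod]; omega) (by omega) hX hXQ
  omega

end Summit.HodgeConjecture.CorCM

end
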